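import Summits.AtomisticToContinuum.FouriersLaw.Theses.HoelderEscapeProfile
import Summits.AtomisticToContinuum.FouriersLaw.Theorems.FibreCalculus.Negative.FalseWithoutGibbs
import Summits.AtomisticToContinuum.FouriersLaw.Theorems.FibreCalculus.Negative.FalseWithoutCarrierAE
import Summits.AtomisticToContinuum.FouriersLaw.Theorems.CurrentTiltQuenchSymmetricSetup
import Literature.MathematicalPhysics.KineticTheory.InfiniteChainAbelWitness

/-!
# Disproof of `FibreCalculus` (stmt-AtomisticToContinuum-16011) — crux disprover's work file

Crux `Summit.AtomisticToContinuum.FouriersLaw.Theses.HoelderEscapeProfile.FibreCalculus` (route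
`HoelderEscapeProfile`, rank 7, "infrastructure"): for EVERY guarded arena `(μ, D)` — `μ` a DLR state of
`pinnedChain ω₂ lam β γ` (`ω₂, lam, β > 0`, `T > 0`), shift- and momentum-reversal-invariant; `D` an
`InfiniteChainDynamics` with `D.PreservesMeasure μ` and `μ`-a.e. shift-covariant flow — the twelve clauses
(1) `Σ_x|⟨j_0, j_x∘φ_t⟩| < ∞ ∀t`; (2) `e^(−νt)C_T ∈ L¹(0,∞)`; (3) `e^(−νt)S(x,·) ∈ L¹`; (4) `Σ(1+x²)|S̄_ν| < ∞`;
(5) `Σ(1+x²)|S(·,0)| < ∞`; (6) `0 < χ(0)`; (7) `Σ_x S̄_ν(x) = χ(0)`; (8) Bochner `f̂_ν ≥ 0`; (9) Parseval at 0;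
(10) `e^(−νt)Σ_x cos(kx)G(x,·) ∈ L¹`; (11) `χ(k) − f̂_ν(k) = (2−2cos k)𝒢_ν(k)/ν`; (12) Helfand–Abel
`∫₀^∞e^(−νt)C_T = (ν/2)(Σ_x x²S̄_ν(x) − Σ_x x²S(x,0))`.

## Findings (cycle 1, seat `refuter-cdisprove-stmt-AtomisticToContinuum-16011-0`, 2026-08-17): NO KILL

* The crux ELABORATES (probe rc 0); constants and signs of (11), (12) re-derived on paper from
  `∂ₜh_x = j_{x−1} − j_x`, `j_x = −½(p_x+p_{x+1})V′(r_x)`: `∂ₜ²S = Δ_xG`, `∂ₜS(·,0) = 0` (STATIC use of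
  reversal: `h` even, `j` odd in `p`), `Σ_x cos(kx)Δ_xG = (2cos k − 2)Ĝ` (no parity of `G` needed), Laplace
  twice — verbatim (11); `Σ_x x²Δ_xG = 2C_T` — verbatim (12). Time-reversal covariance of `D` is NOT a
  hypothesis and is NOT needed. (7) is (11) at `k = 0`; (2) is (10) at `k = 0`; (9) follows from (4).
* NO JUNK MODEL. `IsChainGibbsMeasure` is the junk-free DLR condition + probability (`δ_0`, `0` excluded:
  `not_isChainGibbsMeasure_dirac`); `PreservesMeasure.1` puts `μ`-a.e. point on the carrier, where orbits
  ARE solutions; the arena is inhabited by LANDED theorems (`arena_inhabited` below = the proved crux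
  `SymmetricSetup`, stmt-11036) and the `∀ μ` quantifier ranges over ONE measure per `(ω₂,lam,β,T)`
  (`arena_measure_unique`). A counterexample therefore needs an EXOTIC `μ_T`-preserving solution flow with
  different correlations — not constructible, and excluded on paper by Lanford's a.e. uniqueness
  (= stubs S1+S2 of `Lines/duhamel_koopman_transfer.lean`). Every clause is the expected physics of the
  true dynamics (light cone polynomial in `t` in `L²(μ_T)`; Gibbs tails `e^{−q⁴}` kill fast pulses).
* LOAD-BEARING ANALYSIS (§A): two guards have LANDED separating witnesses —
  `IsChainGibbsMeasure` (frozen arena `δ_0`, p149879, seat rattack) and the a.e.-CARRIER conjunct of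
  `PreservesMeasure` (jump dynamics `φ_t = τ^{±1}`, p159021, this seat). `0 < T` and reversal-invariance
  are REDUNDANT given the other guards (proved below); `0 < lam`, `0 < β` are unused at fixed `ν` (the
  harmonic member satisfies all twelve clauses by Gaussian calculus — paper; arena inhabited for
  `lam, β ≥ 0`, `arena_measure_inhabited_of_nonneg`); `MeasurePreserving` and shift-covariance admit no
  constructible separating witness (a genuine non-canonical solution flow would be needed).
* PRE-TARGET note for the lead (§D): the registered line's stub D (`stub_conservationLawIdentities`) is
  TRUE as typed but MIS-SCOPED — its hypothesis list ((1),(3),(4),(5),(10)) does not contain what the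
  derivation of (11)/(12) consumes: the ABEL-ABSOLUTE summability `∫₀^∞e^(−νt)Σ_x|G(x,t)|dt < ∞`
  (Fubini `Σ_x ↔ ∫dt`), which S4 proves internally (polynomial `L²` cone) but does not export.

## Index
* §A load-bearing analysis: `arena_inhabited`, `arena_measure_unique`, `arena_measure_inhabited_of_nonneg`,
  `posTemp_of_gibbs` (A3), `reversal_of_gibbs_shiftInvariant` (A4), `FibreCalculusWithoutGibbs` /
  `fibreCalculus_false_without_gibbs` (A1, landed p149879), `FibreCalculusWithoutCarrierAE` /
  `fibreCalculus_false_without_carrierAE` (A2, landed p159021).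
* §B tightness: n/a (the crux carries no constant to sharpen).
* §C natural strengthenings: none refutable in Lean (remarks).
* §D targets: none served (no `PICKED.md`); pre-target note on stub D with the corrected hypothesis.
* §E near-misses: none.  §F why it resists.
-/

noncomputable section

open MeasureTheory Filter Set

namespace Summit.AtomisticToContinuum.FouriersLaw.Cruxes.FibreCalculus.Disproof

open Literature.MathematicalPhysics.KineticTheory.HeatConduction
open Summit.AtomisticToContinuum.FouriersLaw.Theses.HoelderEscapeProfile (FibreCalculus SymmetricSetup)

/-! ## §A Load-bearing analysis of the guards -/

/-- **A0 — non-vacuity.** The guarded arena of `FibreCalculus` is INHABITED: the de-vacuifier crux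
`SymmetricSetup` (stmt-AtomisticToContinuum-11036) is a landed theorem (transfer-operator DLR state +
Buttà–Marchioro dynamics on `𝒳₀`). So `FibreCalculus` is not provable by vacuity, and a refutation must
produce a guarded `(μ, D)` violating a clause. [folklore] -/
theorem arena_inhabited : SymmetricSetup :=
  Theorems.CurrentTiltQuench.hoelderEscapeProfile_symmetricSetup_proof

/-- **A0′ — the `∀ μ` quantifier ranges over ONE measure.** Two shift-invariant DLR states of the pinned
chain at the same `T > 0` coincide (tree: uniqueness of the shift-invariant DLR state, `lam, β ≥ 0`).
Hence the crux is a statement about `(μ_T, D)` with `μ_T` fixed and only `D` genuinely universal. [folklore] -/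
theorem arena_measure_unique {ω₂ lam β : ℝ} (γ : ℝ) (hω : 0 < ω₂) (hl : 0 ≤ lam) (hβ : 0 ≤ β)
    {T : ℝ} (hT : 0 < T) {μ₁ μ₂ : Measure ChainConfig}
    (h₁ : (pinnedChain ω₂ lam β γ).IsChainGibbsMeasure T μ₁) (hS₁ : IsShiftInvariant μ₁)
    (h₂ : (pinnedChain ω₂ lam β γ).IsChainGibbsMeasure T μ₂) (hS₂ : IsShiftInvariant μ₂) : μ₁ = μ₂ :=
  OscillatorChain.eq_of_isChainGibbsMeasure_of_isShiftInvariant_pinnedChain γ hω hl hβ hT h₁ hS₁ h₂ hS₂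

/-- **A3 — the guard `0 < T` is NOT load-bearing for truth**: it is implied by the Gibbs guard (the DLR
class of the pinned chain is EMPTY at `T ≤ 0`: `0⁻¹ = 0` / non-normalisable kernels, tree
`isChainGibbsMeasure_pinnedChain_temp_pos`), so dropping it only adds vacuous instances. [folklore] -/
theorem posTemp_of_gibbs {ω₂ lam β γ T : ℝ} (hω : 0 ≤ ω₂) (hl : 0 ≤ lam) (hβ : 0 ≤ β)
    {μ : Measure ChainConfig} (hG : (pinnedChain ω₂ lam β γ).IsChainGibbsMeasure T μ) : 0 < T :=
  isChainGibbsMeasure_pinnedChain_temp_pos hω hl hβ hG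

/-- **A4 — the momentum-reversal guard `μ ∘ R⁻¹ = μ` is REDUNDANT** (hence "possibly unnecessary" for the
prover, and droppable by the planner): a shift-invariant DLR state of the pinned chain is superstable,
unique in that class, and the class is `R`-stable. Stated for `lam, β ≥ 0`. [folklore] -/
theorem reversal_of_gibbs_shiftInvariant {ω₂ lam β : ℝ} (γ : ℝ) (hω : 0 < ω₂) (hl : 0 ≤ lam)
    (hβ : 0 ≤ β) {T : ℝ} (hT : 0 < T) {μ : Measure ChainConfig}
    (hG : (pinnedChain ω₂ lam β γ).IsChainGibbsMeasure T μ) (hS : IsShiftInvariant μ) :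
    μ.map (fun σ : ChainConfig => fun x : ℤ => ((σ x).1, -(σ x).2)) = μ :=
  OscillatorChain.map_momentumReversalZ_eq_of_regular_unique (P := pinnedChain ω₂ lam β γ) hG hS
    (OscillatorChain.hasSuperstabilityEstimate_of_isShiftInvariant_pinnedChain γ hω hl hβ hT hG hS)
    (fun _ _ h₁ s₁ _ h₂ s₂ _ =>
      OscillatorChain.eq_of_isChainGibbsMeasure_of_isShiftInvariant_pinnedChain γ hω hl hβ hT h₁ s₁ h₂ s₂)

/-- **A6 — `0 < lam`, `0 < β` are not used at fixed `ν`; the MEASURE half of the arena is inhabited for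
`lam, β ≥ 0`** (so "not load-bearing" is a claim about truth on a non-empty class, the harmonic member
`lam = β = 0` included, where all twelve clauses hold by Gaussian calculus — paper computation, not
formalised; the route's harmonic failure sits in K1/`AbelSpreadCeiling`, not here). [folklore] -/
theorem arena_measure_inhabited_of_nonneg {ω₂ lam β : ℝ} (γ : ℝ) (hω : 0 < ω₂) (hl : 0 ≤ lam)
    (hβ : 0 ≤ β) {T : ℝ} (hT : 0 < T) :
    ∃ μ : Measure ChainConfig, (pinnedChain ω₂ lam β γ).IsChainGibbsMeasure T μ ∧ IsShiftInvariant μ ∧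
      μ.map (fun σ : ChainConfig => fun x : ℤ => ((σ x).1, -(σ x).2)) = μ := by
  obtain ⟨μ, hG, hS, -⟩ :=
    OscillatorChain.exists_isChainGibbsMeasure_shiftInvariant_superstable_pinnedChain γ hω hl hβ hT
  exact ⟨μ, hG, hS, reversal_of_gibbs_shiftInvariant γ hω hl hβ hT hG hS⟩

/-- **A1 — the statement with the DLR guard weakened to "probability measure"**: `FibreCalculus`
VERBATIM except `(pinnedChain ω₂ lam β γ).IsChainGibbsMeasure T μ ↦ IsProbabilityMeasure μ`. [folklore] -/
def FibreCalculusWithoutGibbs : Prop :=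
  ∀ ω₂ lam β γ : ℝ, 0 < ω₂ → 0 < lam → 0 < β → ∀ T : ℝ, 0 < T → ∀ μ : MeasureTheory.Measure Literature.MathematicalPhysics.KineticTheory.HeatConduction.ChainConfig, MeasureTheory.IsProbabilityMeasure μ → Literature.MathematicalPhysics.KineticTheory.HeatConduction.IsShiftInvariant μ → μ.map (fun σ : Literature.MathematicalPhysics.KineticTheory.HeatConduction.ChainConfig => fun x : ℤ => ((σ x).1, -(σ x).2)) = μ → ∀ D : Literature.MathematicalPhysics.KineticTheory.HeatConduction.InfiniteChainDynamics (Literature.MathematicalPhysics.KineticTheory.HeatConduction.pinnedChain ω₂ lam β γ), D.PreservesMeasure μ → (∀ t : ℝ, ∀ᵐ σ ∂μ, D.flow t (Literature.MathematicalPhysics.KineticTheory.HeatConduction.shift σ) = Literature.MathematicalPhysics.KineticTheory.HeatConduction.shift (D.flow t σ)) → ∀ h : Literature.MathematicalPhysics.KineticTheory.HeatConduction.ChainConfig → ℤ → ℝ, h = (fun (σ : Literature.MathematicalPhysics.KineticTheory.HeatConduction.ChainConfig) (x : ℤ) => (σ x).2 ^ 2 / 2 + (Literature.MathematicalPhysics.KineticTheory.HeatConduction.pinnedChain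 ω₂ lam β γ).U (σ x).1 + ((Literature.MathematicalPhysics.KineticTheory.HeatConduction.pinnedChain ω₂ lam β γ).V ((σ (x + 1)).1 - (σ x).1) + (Literature.MathematicalPhysics.KineticTheory.HeatConduction.pinnedChain ω₂ lam β γ).V ((σ x).1 - (σ (x - 1)).1)) / 2) → ∀ S : ℤ → ℝ → ℝ, S = (fun (x : ℤ) (t : ℝ) => ∫ σ, (h σ 0 - ∫ σ', h σ' 0 ∂μ) * (h (D.flow t σ) x - ∫ σ', h σ' 0 ∂μ) ∂μ) → ∀ Sb : ℝ → ℤ → ℝ, Sb = (fun (ν : ℝ) (x : ℤ) => ν * ∫ t in Set.Ioi (0:ℝ), Real.exp (-(ν * t)) * S x t) → ∀ G : ℤ → ℝ → ℝ, G = (fun (x : ℤ) (t : ℝ) => ∫ σ, (Literature.MathematicalPhysics.KineticTheory.HeatConduction.pinnedChain ω₂ lam β γ).bondCurrentZ σ 0 * (Literature.MathematicalPhysics.KineticTheory.HeatConduction.pinnedChain ω₂ lam β γ).bondCurrentZ (D.flow t σ) x ∂μ) → ∀ Gh : ℝ → ℝ → ℝ, Gh = (fun (ν k : ℝ) => ∫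 t in Set.Ioi (0:ℝ), Real.exp (-(ν * t)) * ∑' x : ℤ, Real.cos (k * (x : ℝ)) * G x t) → ∀ fh : ℝ → ℝ → ℝ, fh = (fun (ν k : ℝ) => ∑' x : ℤ, Real.cos (k * (x : ℝ)) * Sb ν x) → ∀ χk : ℝ → ℝ, χk = (fun k : ℝ => ∑' x : ℤ, Real.cos (k * (x : ℝ)) * S x 0) → (∀ t : ℝ, D.HasAbsConvergentCorrelation μ t) ∧ (∀ ν : ℝ, 0 < ν → MeasureTheory.IntegrableOn (fun t : ℝ => Real.exp (-(ν * t)) * D.currentCorrelation μ t) (Set.Ioi 0)) ∧ (∀ x : ℤ, ∀ ν : ℝ, 0 < ν → MeasureTheory.IntegrableOn (fun t : ℝ => Real.exp (-(ν * t)) * S x t) (Set.Ioi 0)) ∧ (∀ ν : ℝ, 0 < ν → Summable (fun x : ℤ => (1 + (x : ℝ) ^ 2) * |Sb ν x|)) ∧ Summable (fun x : ℤ => (1 + (x : ℝ) ^ 2) * |S x 0|) ∧ 0 < χk 0 ∧ (∀ ν : ℝ, 0 < ν → ∑' x : ℤ, Sb ν x = χk 0) ∧ (∀ ν : ℝ,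 0 < ν → ∀ k : ℝ, 0 ≤ fh ν k) ∧ (∀ ν : ℝ, 0 < ν → ∫ k in (-Real.pi)..Real.pi, fh ν k = 2 * Real.pi * Sb ν 0) ∧ (∀ ν : ℝ, 0 < ν → ∀ k : ℝ, MeasureTheory.IntegrableOn (fun t : ℝ => Real.exp (-(ν * t)) * ∑' x : ℤ, Real.cos (k * (x : ℝ)) * G x t) (Set.Ioi 0)) ∧ (∀ ν : ℝ, 0 < ν → ∀ k : ℝ, χk k - fh ν k = (2 - 2 * Real.cos k) * Gh ν k / ν) ∧ (∀ ν : ℝ, 0 < ν → ∫ t in Set.Ioi (0:ℝ), Real.exp (-(ν * t)) * D.currentCorrelation μ t = ν / 2 * ((∑' x : ℤ, (x : ℝ) ^ 2 * Sb ν x) - ∑' x : ℤ, (x : ℝ) ^ 2 * S x 0))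

/-- **A1 — it is FALSE: the DLR guard is load-bearing** (LANDED
`Theorems/FibreCalculus/Negative/FalseWithoutGibbs.lean`, p149879, seat rattack): frozen arena `μ = δ_0`,
carrier `{0}`, `φ_t = id` (admissible since `U′(0) = 0`); clause (6) fails (`S ≡ 0`). Reading for provers:
positivity `0 < χ(0)` (and every moment bound) needs the DLR equations themselves — invariance, symmetry
and ergodicity of `μ` do not suffice. [folklore] -/
theorem fibreCalculus_false_without_gibbs : ¬ FibreCalculusWithoutGibbs :=
  Theorems.FibreCalculus.Negative.fibreCalculus_false_without_isChainGibbsMeasure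

/-- **A2 — the statement with the a.e.-CARRIER conjunct of `PreservesMeasure` dropped**:
`FibreCalculus` VERBATIM except `D.PreservesMeasure μ ↦ ∀ t, MeasurePreserving (D.flow t) μ μ`.
In the crux, Newton's equations reach the twelve conclusions ONLY through `PreservesMeasure.1`
(`∀ᵐ σ ∂μ, σ ∈ D.carrier`, where orbits are solutions). [folklore] -/
def FibreCalculusWithoutCarrierAE : Prop :=
  ∀ ω₂ lam β γ : ℝ, 0 < ω₂ → 0 < lam → 0 < β → ∀ T : ℝ, 0 < T → ∀ μ : MeasureTheory.Measure Literature.MathematicalPhysics.KineticTheory.HeatConduction.ChainConfig, (Literature.MathematicalPhysics.KineticTheory.HeatConduction.pinnedChain ω₂ lam β γ).IsChainGibbsMeasure T μ → Literature.MathematicalPhysics.KineticTheory.HeatConduction.IsShiftInvariant μ → μ.map (fun σ : Literature.MathematicalPhysics.KineticTheory.HeatConduction.ChainConfig => fun x : ℤ => ((σ x).1, -(σ x).2)) = μ → ∀ D : Literature.MathematicalPhysics.KineticTheory.HeatConduction.InfiniteChainDynamics (Literature.MathematicalPhysics.KineticTheory.HeatConduction.pinnedChain ω₂ lam β γ), (∀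 t : ℝ, MeasureTheory.MeasurePreserving (D.flow t) μ μ) → (∀ t : ℝ, ∀ᵐ σ ∂μ, D.flow t (Literature.MathematicalPhysics.KineticTheory.HeatConduction.shift σ) = Literature.MathematicalPhysics.KineticTheory.HeatConduction.shift (D.flow t σ)) → ∀ h : Literature.MathematicalPhysics.KineticTheory.HeatConduction.ChainConfig → ℤ → ℝ, h = (fun (σ : Literature.MathematicalPhysics.KineticTheory.HeatConduction.ChainConfig) (x : ℤ) => (σ x).2 ^ 2 / 2 + (Literature.MathematicalPhysics.KineticTheory.HeatConduction.pinnedChain ω₂ lam β γ).U (σ x).1 + ((Literature.MathematicalPhysics.KineticTheory.HeatConduction.pinnedChain ω₂ lam β γ).V ((σ (x + 1)).1 - (σ x).1) + (Literature.MathematicalPhysics.KineticTheory.HeatConduction.pinnedChain ω₂ lam β γ).V ((σ x).1 - (σ (x - 1)).1)) / 2) → ∀ S : ℤ → ℝ → ℝ, S = (fun (x : ℤ) (t : ℝ) => ∫ σ, (h σ 0 - ∫ σ', h σ' 0 ∂μ) * (h (D.flow t σ) x - ∫ σ', h σ' 0 ∂μ) ∂μ) → ∀ Sb : ℝ → ℤ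 → ℝ, Sb = (fun (ν : ℝ) (x : ℤ) => ν * ∫ t in Set.Ioi (0:ℝ), Real.exp (-(ν * t)) * S x t) → ∀ G : ℤ → ℝ → ℝ, G = (fun (x : ℤ) (t : ℝ) => ∫ σ, (Literature.MathematicalPhysics.KineticTheory.HeatConduction.pinnedChain ω₂ lam β γ).bondCurrentZ σ 0 * (Literature.MathematicalPhysics.KineticTheory.HeatConduction.pinnedChain ω₂ lam β γ).bondCurrentZ (D.flow t σ) x ∂μ) → ∀ Gh : ℝ → ℝ → ℝ, Gh = (fun (ν k : ℝ) => ∫ t in Set.Ioi (0:ℝ), Real.exp (-(ν * t)) * ∑' x : ℤ, Real.cos (k * (x : ℝ)) * G x t) → ∀ fh : ℝ → ℝ → ℝ, fh = (fun (ν k : ℝ) => ∑' x : ℤ, Real.cos (k * (x : ℝ)) * Sb ν x) → ∀ χk : ℝ → ℝ, χk = (fun k : ℝ => ∑' x : ℤ, Real.cos (k * (x : ℝ)) * S x 0) → (∀ t : ℝ, D.HasAbsConvergentCorrelation μ t) ∧ (∀ ν : ℝ, 0 < ν → MeasureTheory.IntegrableOn (fun t : ℝ => Real.exp (-(ν * t))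 * D.currentCorrelation μ t) (Set.Ioi 0)) ∧ (∀ x : ℤ, ∀ ν : ℝ, 0 < ν → MeasureTheory.IntegrableOn (fun t : ℝ => Real.exp (-(ν * t)) * S x t) (Set.Ioi 0)) ∧ (∀ ν : ℝ, 0 < ν → Summable (fun x : ℤ => (1 + (x : ℝ) ^ 2) * |Sb ν x|)) ∧ Summable (fun x : ℤ => (1 + (x : ℝ) ^ 2) * |S x 0|) ∧ 0 < χk 0 ∧ (∀ ν : ℝ, 0 < ν → ∑' x : ℤ, Sb ν x = χk 0) ∧ (∀ ν : ℝ, 0 < ν → ∀ k : ℝ, 0 ≤ fh ν k) ∧ (∀ ν : ℝ, 0 < ν → ∫ k in (-Real.pi)..Real.pi, fh ν k = 2 * Real.pi * Sb ν 0) ∧ (∀ ν : ℝ, 0 < ν → ∀ k : ℝ, MeasureTheory.IntegrableOn (fun t : ℝ => Real.exp (-(ν * t)) * ∑' x : ℤ, Real.cos (k * (x : ℝ)) * G x t) (Set.Ioi 0)) ∧ (∀ ν : ℝ, 0 < ν → ∀ k : ℝ, χk k - fh ν k = (2 - 2 * Real.cos k) * Gh ν k / ν) ∧ (∀ ν : ℝ,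 0 < ν → ∫ t in Set.Ioi (0:ℝ), Real.exp (-(ν * t)) * D.currentCorrelation μ t = ν / 2 * ((∑' x : ℤ, (x : ℝ) ^ 2 * Sb ν x) - ∑' x : ℤ, (x : ℝ) ^ 2 * S x 0))

/-- **A2 — it is FALSE** (LANDED `Theorems/FibreCalculus/Negative/FalseWithoutCarrierAE.lean`, p159021,
this seat; unconditional). Witness: the tree's symmetric DLR state `μ` (A6/A4) and the JUMP dynamics
(carrier `∅`, `φ_0 = id`, `φ_t = τ^{±1}` for `t ≠ 0`) — measure-preserving, shift-commuting, all symmetry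
guards intact. Then `S̄_ν(x) = S₀(x±1)` for every `ν > 0`, `S(x,0) = S₀(x)`, `C_T` constant on `t > 0`;
Helfand–Abel (12) at `ν = 1, 2` forces `Σ x²S₀(x±1) = Σ x²S₀(x)`, and `(y+1)²+(y−1)²−2y² = 2` with the
summability (5) gives `2Σ_xS₀(x) = 0`, contradicting (6). Reading for provers: any proof of (11)/(12) must
use `D.isSolution` through the a.e.-carrier clause; measure preservation + shift covariance + symmetries of
`μ` are blind to the equations of motion (they hold for the bare lattice shift). [folklore] -/
theorem fibreCalculus_false_without_carrierAE : ¬ FibreCalculusWithoutCarrierAE :=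
  Theorems.FibreCalculus.Negative.fibreCalculus_false_without_carrierAE

/-! ### A7 — guards with no constructible separating witness (remarks)

* `PreservesMeasure.2` (`MeasurePreserving (D.flow t) μ μ`) and the shift-covariance guard
  `∀ t, ∀ᵐ σ, φ_t(τσ) = τ(φ_t σ)`: a separating witness is a GENUINE solution flow on a `μ_T`-full carrier
  that does not preserve `μ_T` / does not commute with `τ`. Every dynamics the tree can build is the
  Buttà–Marchioro flow on `𝒳₀` (`exists_bmDynamics`), which preserves `μ_T`
  (`preservesMeasure_of_carrier_eq_bmGood`) and is `τ`-covariant on `𝒳₀`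
  (`flow_comp_chainShift_ae_of_carrier_eq_bmGood`); time-rescaled or shifted orbits are not solutions
  (no scaling symmetry for `U = ω₂q²/2 + lam q⁴/4`). Physically both guards are consequences of a.e.
  uniqueness of tempered solutions (Lanford–Lebowitz–Lieb Thm 4 class) and thus redundant-in-truth but
  load-bearing for PROVABILITY as typed (the `unique` field only speaks inside `D.carrier`, which need not
  be `𝒳₀`).
* `IsShiftInvariant μ`: a separating witness is a non-shift-invariant DLR state; for the superstable class
  none exists (uniqueness), non-tempered DLR states are not constructible. Redundant-in-truth.
* `0 < ω₂`: used by every existence/uniqueness theorem of the tree (confinement `U ≥ ω₂q²/2`); with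
  `ω₂ ≤ 0 < lam` the statement is still expected true (quartic confinement) but the tree has no arena.
-/

/-! ## §B Tightness — not applicable

The crux asserts identities and qualitative summabilities at each fixed `ν > 0`; it carries no constant or
exponent that a boundary example could show to be sharp. (The quantitative objects — `C` of K1, `B` of the
ceiling, `χ³/(512π²C′²)` of `closes` — live in the sibling cruxes.) -/

/-! ## §C Natural strengthenings — remarks (nothing refutable in Lean today)

* UNIFORM-in-`ν` versions of (4) (`sup_ν Σ(1+x²)|S̄_ν| < ∞`) or of (1) in `t` are FALSE physically
  (`Σx²S̄_ν ≍ 2χD/ν` diffusively, `≍ ν⁻²` at the harmonic member) — but a Lean refutation needs the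
  harmonic Gaussian calculus of the infinite chain, not in the tree. Planners: do not strengthen (4) to a
  `ν`-uniform bound; the `1/ν` rate is exactly `AbelSpreadCeiling`.
* POINTWISE sign strengthenings (`S̄_ν(x) ≥ 0`, `f̂_ν` non-increasing in `|k|`, `G_ν(x) ≥ 0`): the last is
  false already statically at `x = ±1` (`Cov(V′(r_0),V′(r_1)) < 0`, route text); none is asserted by the
  crux and none should be added.
* Dropping the summability guards inside the conclusions is impossible by design: every `tsum`/Bochner
  object of (6)–(12) is covered by (1),(3),(4),(5),(10) (no clause can hold "by junk").
-/

/-! ## §D Targets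

No line is picked (`PICKED.md` absent, payload `stuck_stubs = []`), so no stub is a target yet.
PRE-TARGET NOTE on the registered skeleton `Lines/duhamel_koopman_transfer.lean` (shared stubs A, C, D with
`Lines/birth.lean`), for the lead's first turn:

* `stub_conservationLawIdentities` (D) is TRUE as typed (it is (11)∧(12) for genuine `(μ, D)` under true
  side conditions) but its hypothesis list — (1) `Σ_x|G(x,t)| < ∞` pointwise in `t`, (3), (4), (5), (10) —
  is NOT what a derivation consumes. The derivation (per-`x` Laplace transform of `∂ₜ²S = Δ_xG` with the
  bounded, continuous `S, ∂ₜS, G` that measure preservation gives; then the cosine transform / second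
  `x`-moment) needs ONE exchange `Σ_x ↔ ∫₀^∞e^(−νt)dt` applied to `G`, i.e. the ABEL-ABSOLUTE summability

      ∀ ν : ℝ, 0 < ν → (∀ x : ℤ, IntegrableOn (fun t : ℝ => Real.exp (-(ν * t)) * G x t) (Set.Ioi 0)) ∧
        Summable (fun x : ℤ => ∫ t in Set.Ioi (0:ℝ), Real.exp (-(ν * t)) * |G x t|)

  (equivalently `∫₀^∞e^(−νt)Σ_x|G(x,t)|dt < ∞`), which follows from S4's internal polynomial cone
  `Σ_x(1+x²)(|S|+|G|)(x,t) ≤ A(1+|t|)^m` but is NOT exported by `stub_temperedOfLightCone`'s conclusion.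
  Without it the prover of D must redo S2+S4. Suggested repair (lead/planner): add the displayed clause to
  S4's conclusion and to D's hypotheses (both lines, shared stub). With it, everything else is 1-D lattice
  potential theory: `G̃_ν := ∫e^(−νt)G(·,t)` is bounded (`|G| ≤ ‖j_0‖₂²`) and tends to `0` at `±∞` ((1) +
  dominated convergence), `Δ_xG̃_ν = ν(S̄_ν − S(·,0)) =: r` with `Σ(1+x²)|r| < ∞` ((4),(5)); boundedness
  alone forces `Σ_x r(x) = 0` (= conservation (7)), the limits force `Σ_x x·r(x) = 0`, whence
  `G̃_ν(x) = Σ_{y>x}(y−x)r(y)` (`x ≥ 0`) is in `ℓ¹` and `Σ_x cos(kx)Δ_xG̃_ν = (2cos k−2)Σ_x cos(kx)G̃_ν`,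
  `Σ_x x²Δ_xG̃_ν = 2Σ_xG̃_ν` — (11) and (12) after the single Fubini. Evenness of `S` in `x` and
  time-reversal covariance of `D` are NOT needed anywhere.
* Stubs S1 (`stub_koopmanLiouvilleGenerator`), S2, S4, A, C: no misstatement found; S1's `∀ D` form is
  sound (chain rule on the full-measure carrier, joint measurability of `(u,σ) ↦ φ_uσ` on a measurable
  full-measure subset of the carrier by Carathéodory, strong continuity of the Koopman group from a.e.
  orbit continuity + isometry).
-/

/-! ## §E Near-misses — none -/

/-! ## §F Why the crux resists (for the provers)

1. The only constructible guarded arenas are `(μ_T, D)` with `μ_T` THE shift-invariant DLR state and `D`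
   a.e. equal to the Buttà–Marchioro flow on its carrier ∩ `𝒳₀` whenever the carrier is comparable with
   `𝒳₀`; for such `D` every clause is the standard (expected, unprinted) infinite-volume Green–Kubo
   calculus. An exotic `μ_T`-preserving solution flow with different two-point functions would refute the
   crux but contradicts Lanford's a.e. uniqueness; it cannot be built here.
2. The junk directions are closed: DLR is junk-free (A1's `δ_0` needs the Gibbs guard dropped), the
   carrier clause pins the orbits to solutions (A2's jump flows need it dropped), `T ≤ 0` is empty (A3).
3. The identities (11), (12) are correctly normalised (sign, `1/ν`, `ν/2`), so no "off-by-constant" kill.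
The remaining risk is physical (a super-polynomial `L²` light cone for the quartic chain making
`Σ_x x²|S(x,t)|` grow faster than every `e^{νt}` — excluded heuristically by the `e^{−q⁴}` Gibbs tails of
fast pulses), which no finite computation certifies.
-/

end Summit.AtomisticToContinuum.FouriersLaw.Cruxes.FibreCalculus.Disproof

end
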